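/-
Copyright: pub-hodgecm formalisation cell (harness21, 2026). New file (not vendored).
-/
import Summits.HodgeConjecture.HodgeCM.Geometry.Facts
import Summits.HodgeConjecture.HodgeCM.Geometry.WeightVectors
import Summits.HodgeConjecture.HodgeCM.StubTree.Inputs
import Summits.HodgeConjecture.HodgeCM.Proofs.Landherr
import Summits.HodgeConjecture.HodgeCM.Proofs.SurfaceCriterion
import Summits.HodgeConjecture.HodgeCM.Prior.AllgGroup_2
import Summits.HodgeConjecture.HodgeCM.Prior.Qw8Sufficiency

/-!
# Stub tree, part 2: from the period theorem to COR-CM (rfwf §2, §8; QW8)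

```
rfwf Prop 2.2  surface criterion                      `prop22_surfaceCriterion` (PROVED, gen 4: `Universe.surfaceCriterion_holds`)
Landherr       ∃ (V₃,h) of signature (2,1),(3,0)^{g-1}  `landherr_exists` (PROVED, gen 3: `HodgeCM.Proofs.Landherr` — Dirichlet's unit
                                                        theorem gives `a ∈ L⁺` negative exactly at the place of `ι₁`; `h = diag(1,1,a)`)
(ii)           Pohlmann 1968 ([QW8] L2.2)               hypothesis `Universe.PohlmannSpan` (OPEN INPUT; gen-5 stub `pohlmann_span`)
(iii)          [QW8] Thm 2.5 + §3 ā-bridge + Milne 1999 hypothesis `Universe.Qw8Sufficiency` (OPEN INPUT; gen-5 stub `qw8_sufficiency`; combinatorial core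
                                                        (i)–(v) PROVED abstractly: `HodgeCM.Prior.Qw8Sufficiency.sufficiency_int`)
(iv)           l:allg + corner dictionary ⇒ a(e_S) ∈ ā(faces)  PROVED, gen 5: `HodgeCM.lefChar_eq_sum_faces` (from
                                                        `HodgeCM.Prior.AllgGroup.gfaces_generate`, all g)
(ii)–(iv)      face reduction                           `faceReduction_holds` (PROVED as glue from (ii),(iii), gen 5 — was a STUB in gen 1–4)
rfwf L 8.1     reduction to ∏ A_Φ over one Galois F     `lemma81_holds` (PROVED from `Fact_cmDominated` = Shimura–Taniyama +
                                                        Poincaré, and functoriality `Fact_pull_comp/_hodge/_alg`)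
```
Since gen 6 this file contains no placeholder proof: rows (ii) and (iii) are the named open inputs
`Universe.PohlmannSpan` / `Universe.Qw8Sufficiency` (definitions, `HodgeCM.Geometry.WeightVectors`;
record `Universe.OpenInputs` in `HodgeCM.StubTree.Inputs`), taken as explicit hypotheses.
-/

noncomputable section

open scoped TensorProduct

namespace HodgeCM

open Literature.AlgebraicGeometry.Motives (HodgeStructure)
open Literature.AlgebraicGeometry.Motives.HodgeStructure (ofRat)

namespace StubTree

/-- **rfwf Prop 2.2** `p:surf` (tex ll. 101–108; PROVED in gen 4 — was a stub in gen 1–3). "Lefschetz/Gysin on `S` plus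
`F`-eigencharacter bookkeeping": the period data give a morphism `fP : S → P(f)` and an `ι₁`-Weil generator `y`
of `W_F(P(f)) ⊗ ℂ` with `∫_S fP^* y =` the period (Steps A–D, the `Face.psi`/`Face.corner` dictionary,
`HodgeCM.Universe.exists_weilGen_pullback`); Gysin (M26) rewrites this as `∫_P y ∪ cl(fP_*[S])` with
`cl(fP_*[S]) ∈ Alg^{d-2}(P)`; a Weil generator pairing non-trivially with an algebraic class forces
`W_F(P) ∩ Alg²(P) ≠ 0` (diagonal `𝓞_F`-action M24, degree M25, Poincaré/Fourier duality M28, a separating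
integer and a Lagrange/Bézout argument), and then `W_F(P) ⊆ Alg²(P)` because `W_F(P)` is an irreducible
`ℚ[T]`-module of rank `[F:ℚ]` (M12). Full proof: `HodgeCM.Universe.surfaceCriterion_holds`
(`HodgeCM/Proofs/SurfaceCriterion.lean` and `HodgeCM/Proofs/Prop22/*`), from the model facts M1–M28 only. -/
theorem prop22_surfaceCriterion (U : Universe) (M : U.ModelAxioms) : U.SurfaceCriterion :=
  Universe.surfaceCriterion_holds M

/-- **Landherr's existence theorem** (PROVED in gen 3 — was a stub; Landherr 1936; Scharlau Ch. 10, existence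
direction only): hermitian spaces over a CM field with prescribed signatures at the real places of `L₀` exist;
here rank 3, signature `(2,1)` at `ι₁` and `(3,0)` elsewhere: `h = ⟨1, 1, a⟩` with `a ∈ L⁺` negative exactly at
the place under `ι₁` — `a = 1 - u ū` for a Dirichlet unit `u` small at every other place
(`HodgeCM.exists_neg_at_pos_off`, `HodgeCM.landherr_exists_proof` in `HodgeCM/Proofs/Landherr.lean`). -/
theorem landherr_exists : Universe.LandherrExists :=
  landherr_exists_proof

/-! **Rows (ii) and (iii)** — since gen 6 the two inputs (Pohlmann's span theorem in product form; one internal reduction anchored in print) are the named open inputs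
`HodgeCM.Universe.PohlmannSpan` (Pohlmann, Ann. of Math. 88 (1968), Thm 1; [QW8] Lemma 2.2 — needs, in the
model, Künneth in all degrees, the exterior-algebra structure of `H^•` of an abelian variety, the eigen-
decomposition of `H¹(A_Θ) ⊗ ℂ` and Galois descent for `B^p ⊗ ℚ̄`) and `HodgeCM.Universe.Qw8Sufficiency`
([QW8] Thm 2.5 (i)–(v) + §3, geometric input Milne, *Lefschetz classes on abelian varieties*, Duke Math. J. 96
(1999), Thm 3.2 / Cor 4.5; combinatorial core machine-checked: `HodgeCM.Prior.Qw8Sufficiency`), hypotheses of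
`faceReduction_holds` and of `HodgeCM.Assembly.COR_CM`; gen 5 had them as the stubs `pohlmann_span`,
`qw8_sufficiency`. -/

/-- **Face reduction (ii)–(iv)** — PROVED as glue (gen 5; was an opaque stub in gen 1–4). For `F` Galois CM,
`[F:ℚ] ≥ 6`: `(∀ faces f, W_F(P(f)) algebraic) → HC(∏_j A_{(F,Θ_j)})`.  Proof: a rational Hodge class `c`
complexifies into the span of weight vectors `x` of Hodge weights `S` (`hP : PohlmannSpan`); for each such `S`
the Lefschetz character `a(e_S)` is an integer combination of face characters — PROVED for all `g` from the
lattice theorem `l:allg` (`HodgeCM.Prior.AllgGroup.RfwfAllgGroup.gfaces_generate`) transported along the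
torsor `Hom(F, ℂ) ≃ E` and the corner dictionary (`HodgeCM.lefChar_eq_sum_faces`); so `x ∈ Alg ⊗ ℂ`
(`hQ : Qw8Sufficiency`), hence `c ⊗ 1 ∈ Alg ⊗ ℂ` and `c ∈ Alg` (`Universe.mem_alg_of_ofRat_mem_algC`: a
`ℚ`-linear retraction `ℂ → ℚ`).  No model fact is used: the glue is pure. -/
theorem faceReduction_holds (U : Universe) (hP : U.PohlmannSpan) (hQ : U.Qw8Sufficiency) :
    U.FaceReduction := by
  intro F hGal hdeg hfaces n Θ p c hc
  haveI := hGal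
  have h1 : (ofRat c : U.CohC (U.cmProd F Θ) (2 * p)) ∈
      Submodule.span ℂ {x : U.CohC (U.cmProd F Θ) (2 * p) |
        ∃ S : Fin (n + 1) → Finset ((F : Type) →+* ℂ),
          IsHodgeWeight Θ p S ∧ U.IsWeightVector F Θ S (2 * p) x} :=
    hP F hGal hdeg n Θ p (Submodule.mem_map_of_mem hc)
  have h2 : Submodule.span ℂ {x : U.CohC (U.cmProd F Θ) (2 * p) |
        ∃ S : Fin (n + 1) → Finset ((F : Type) →+* ℂ),
          IsHodgeWeight Θ p S ∧ U.IsWeightVector F Θ S (2 * p) x} ≤ U.algC (U.cmProd F Θ) p := by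
    rw [Submodule.span_le]
    rintro x ⟨S, hS, hx⟩
    obtain ⟨m, f, cf, hsum⟩ := lefChar_eq_sum_faces Θ S hS (Classical.arbitrary ((F : Type) →+* ℂ))
    exact hQ F hGal hdeg hfaces n Θ p S x hS hx ⟨_, m, f, cf, hsum⟩
  exact U.mem_alg_of_ofRat_mem_algC (h2 h1)

/-- Pullback of a rational Hodge class is a rational Hodge class (`Fact_pull_hodge` on `1 ⊗ y`). -/
theorem pull_mem_hodgeClassesOf {U : Universe} (hH : U.Fact_pull_hodge) {X Y : U.Var} (f : U.Mor X Y)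
    (p : ℕ) {y : U.Coh Y (2 * p)} (hy : y ∈ U.hodgeClassesOf Y p) :
    U.pull f (2 * p) y ∈ U.hodgeClassesOf X p := by
  unfold Universe.hodgeClassesOf at hy ⊢
  rw [HodgeStructure.mem_hodgeClasses_iff] at hy ⊢
  have e : ofRat (U.pull f (2 * p) y) = U.pullC f (2 * p) (ofRat y) := by
    simp [HodgeStructure.ofRat_apply, Universe.pullC, LinearMap.baseChange_tmul]
  rw [e]
  exact hH X Y f (2 * p) p (Submodule.mem_map_of_mem hy)

/-- **rfwf v3 Lemma 8.2** `l:reduce` (decl name historical) — PROVED (gen 2; referee 2 G2) from the structural fact `Fact_cmDominated`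
(= [MilneLP] (i); André, *Une remarque à propos des cycles de Hodge de type CM* (1992) §1; Shimura–Taniyama +
Poincaré: every CM abelian variety `X` admits `s : X → A′ = ∏_j A_{(F,Θ_j)}`, `π : A′ → X` over one Galois CM
field `F` of degree `≥ 6` with `(π ∘ s)^* = N^k`, `N ≠ 0`) and functoriality: a Hodge class `y` on `X` pulls
back to a Hodge class `π^* y` on `A′` (`Fact_pull_hodge`), algebraic by hypothesis, so `s^* π^* y = N^{2p} y`
is algebraic (`Fact_pull_alg`, `Fact_pull_comp`), hence so is `y`. -/
theorem lemma81_holds (U : Universe) (M : U.ModelAxioms) : U.Lemma81 := by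
  intro hprod X hX p y hy
  obtain ⟨F, hG, h6, n, Θ, s, π, N, hN, hpull⟩ := M.cmDominated X hX
  have h1 : U.pull π (2 * p) y ∈ U.hodgeClassesOf (U.cmProd F Θ) p :=
    pull_mem_hodgeClassesOf M.pull_hodge π p hy
  have h2 : U.pull π (2 * p) y ∈ U.alg (U.cmProd F Θ) p := hprod F hG h6 n Θ p h1
  have h3 : U.pull s (2 * p) (U.pull π (2 * p) y) ∈ U.alg X p :=
    M.pull_alg _ _ s p (Submodule.mem_map_of_mem h2)
  have h4 : U.pull s (2 * p) (U.pull π (2 * p) y) = ((N : ℚ) ^ (2 * p)) • y := by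
    have e := hpull (2 * p)
    rw [M.pull_comp] at e
    simpa using LinearMap.congr_fun e y
  rw [h4] at h3
  have hNq : ((N : ℚ) ^ (2 * p)) ≠ 0 := pow_ne_zero _ (Nat.cast_ne_zero.mpr hN)
  have h5 := Submodule.smul_mem (U.alg X p) (((N : ℚ) ^ (2 * p))⁻¹) h3
  rwa [inv_smul_smul₀ hNq] at h5

end StubTree

end HodgeCM

end
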